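import Literature.MathematicalPhysics.QuantumFieldTheory.Balaban1983to89.B16RLeafRecord13LiveRstep
import Literature.MathematicalPhysics.QuantumFieldTheory.Balaban1983to89.Node00.Record13SepCoPHChi
import Literature.MathematicalPhysics.QuantumFieldTheory.Balaban1983to89.Node00.Record13ResidualsRChi
import Literature.MathematicalPhysics.QuantumFieldTheory.Balaban1983to89.B16RLeafRecord13LiveChi
import Literature.MathematicalPhysics.QuantumFieldTheory.Balaban1983to89.B16RLeafRecord13AtLiveChi
import Literature.MathematicalPhysics.QuantumFieldTheory.Balaban1983to89.Node00.Record13LiveSelectorChi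

/-!
# χ-GENERIC RE-ISSUE (WORK ORDER RC-1 «RE-CENTRE THE RECORD», director-ym №462 (B) ∕ №467 (D)) of `B16RLeafRecord13LiveRstep`

Cell `pub-ymgap` (HUMAN RULING D-0062, Track A), seat `pub-ymgap-dag-n11-d` (N11 [B14] s2; N11-σ campaign, `N11-G44-RC1-REACH-CENSUS.md`).  The CENTRE-TYPED
declarations of `B16RLeafRecord13LiveRstep` (those whose statement reads the (2.9) cut-off centre through `gOfRecord₁₃ ∕ EOfRecord₁₃ ∕ Provisos₁₃… ∕ T∕SLaw₁₃… ∕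
UbgOfRecord₁₃… ∕ WtOfRecord₁₃… ∕ datum∕tower∕coreOfRecord₁₃…`) RE-ISSUED VERBATIM in the β-slot `χ : ChiSlot F N` over [Ax-3b]∕[Ax-3c]∕[Ax-3d]'s χ-generic carriers
(`Node00/Record13Chi` ∕ `Record13CoPHChi` ∕ `Record13SepCoPHChi`): σ = (binder `(χ : ChiSlot F N)` after `θ`; Node00 defs `X ↦ XChi … χ`; Node00 rows `Y ↦ Y_chi`;
this lane's sibling modules `…Chi` for Summits-side dependencies); SAME short names in the sibling namespace `…B16RLeafRecord13LiveRstepChi` (consumers switch by namespace);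
the 61 centre-FREE declarations of the original are NOT copied — they are reused BY NAME (`open … (…)` below).  At `χ := chiβOfRecord₁₃ θ` every statement here is
DEFINITIONALLY the landed one ([Ax-3b]'s `rfl` receipts); at `χ := chiβOfRecord₁₃Ax θ` it is what the Ax-record's N11 machine reads.  Nothing of record edited (body-freeze №460 (2)).

v1 (dag-n11-d g44): ONE row now (`slotsOfRecord₁₃_succ_ae_eq_slotsT_of_fix_of_dead_of_rstep`); the second cone row `rstep₁₃_of_liveSel_of_hasResiduals`
reads `Record13` §4c's `rstep₁₃_of_localBg_liveSel` in χ (node00-def-Y's `Record13LiveSelectorChi`, H3.1 (a)) and follows as an APPEND-ONLY v1.1 when that lands.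

HONEST FRAMING.  Count-neutral kernel re-elaboration of landed N11 bookkeeping∕estimates in a parameter; every HYPOTHESIS of the original stays a hypothesis; nothing of
Bałaban asserted beyond what the original file proves; N11 NOT discharged; K-items untouched; counts unmoved.  One finite `𝕋⁴_{L^K}` programme at fixed `ε = L^{−K}` —
NOT ℝ⁴, NOT OS, NOT a mass gap, NOT Clay.  No `sorry`∕`instance`∕`notation`.  Sources: as the original module, plus [I] = [Balaban1987RG1] (2.9) p.266 (the cut-off's centre).
-/

noncomputable section

open MeasureTheory
open scoped BigOperators Matrix.Norms.L2Operator

namespace Literature.MathematicalPhysics.QuantumFieldTheory.Balaban1983to89.B16RLeafRecord13LiveRstepChi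

open Literature.MathematicalPhysics.QuantumFieldTheory.Balaban1983to89.B16RLeafRecord13LiveRstep (rstep_of_provisos₁₃ sLaw₁₃_succ_of_tLaw₁₃_of_idem_of_dead_of_rstep rOpLeaf_VOfRecord₁₃_of_idem_of_dead_of_rstep laws₁₃_of_idem_of_dead_of_rstep rOperation_leavesP_of_idem_of_dead₁₃_of_rstep densOfRecord₁₃_succ_ae_eq_tdens_of_idem_of_dead_of_rstep sLaw₁₃_succ_of_tLawLive_of_idem_of_dead_of_rstep sLaw₁₃_all_of_thmP245Live_of_idem_of_dead_of_rstep sLaw₁₃_all_of_thmP245_of_idem_of_dead_of_rstep rOpLeaf_VOfRecord₁₃_of_liveSel_of_rstep laws₁₃_of_liveSel_of_rstep rOperation_leavesP_of_liveSel₁₃_of_rstep densOfRecord₁₃_succ_ae_eq_tdens_of_liveSel_of_rstep sLaw₁₃_succ_of_tLawLiveSeq_of_liveSel_of_rstep sLaw₁₃_all_of_thmP245LiveSeq_of_liveSel_of_rstep sLaw₁₃_all_of_thmP245_of_liveSel_of_rstep rOpLeaf_VOfRecord₁₃_of_liveSel_of_hasResiduals laws₁₃_of_liveSel_of_hasResiduals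 rOperation_leavesP_of_liveSel₁₃_of_hasResiduals densOfRecord₁₃_succ_ae_eq_tdens_of_liveSel_of_hasResiduals sLaw₁₃_all_of_thmP245LiveSeq_of_liveSel_of_hasResiduals sLaw₁₃_all_of_thmP245_of_liveSel_of_hasResiduals rOpLeaf_VOfRecord₁₃_liveRepin₁₃_of_hasResiduals laws₁₃_liveRepin₁₃_of_hasResiduals rOperation_leavesP_liveRepin₁₃_of_hasResiduals densOfRecord₁₃_succ_ae_eq_tdens_liveRepin₁₃_of_hasResiduals sLaw₁₃_all_liveRepin₁₃_of_thmP245_of_hasResiduals rOpLeaf_VOfRecord₁₃_theta13LiveOfFamily laws₁₃_theta13LiveOfFamily densOfRecord₁₃_succ_ae_eq_tdens_theta13LiveOfFamily rOpLeaf_VOfRecord₁₃_theta13LiveOfRecord laws₁₃_theta13LiveOfRecord rOperation_leavesP_theta13LiveOfRecord densOfRecord₁₃_succ_ae_eq_tdens_theta13LiveOfRecord_closed sLaw₁₃_all_theta13LiveOfRecord_of_thmP245 rOpLeaf_VOfRecord₁₃_theta13LiveOfFamily₂ laws₁₃_theta13LiveOfFamily₂ densOfRecord₁₃_succ_ae_eq_tdens_theta13LiveOfFamily₂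 rOpLeaf_VOfRecord₁₃_theta13LiveOfNumerics laws₁₃_theta13LiveOfNumerics densOfRecord₁₃_succ_ae_eq_tdens_theta13LiveOfNumerics kappa_nonneg_theta13OfThm1 E0_nonneg_theta13OfThm1 B0_nonneg_theta13OfThm1 rOpLeaf_VOfRecord₁₃_theta13OfThm1 laws₁₃_theta13OfThm1 rOperation_leavesP_theta13OfThm1 densOfRecord₁₃_succ_ae_eq_tdens_theta13OfThm1 sLaw₁₃_all_theta13OfThm1_of_thmP245 b14_main_at_record₁₃_theta13OfThm1 thm1Printed_datumOfRecord₁₃_theta13OfThm1_of_laws kappa_nonneg_theta13OfThm1C E0_nonneg_theta13OfThm1C B0_nonneg_theta13OfThm1C rOpLeaf_VOfRecord₁₃_theta13OfThm1C laws₁₃_theta13OfThm1C rOperation_leavesP_theta13OfThm1C densOfRecord₁₃_succ_ae_eq_tdens_theta13OfThm1C sLaw₁₃_all_theta13OfThm1C_of_thmP245 b14_main_at_record₁₃_theta13OfThm1C thm1Printed_datumOfRecord₁₃_theta13OfThm1C_of_laws)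
open T4Continuum T4DatumAssembly Node00 B14.Eq218Concrete DagBinding
open B16RLeafRecord11 B16RLeafRecord12 B16RLeafRecord12Live B16RLeafRecord12AtLive
open B16RLeafRecord13AtLive
open B16RLeafRecord13Live hiding dead_of_ppSel_succ_ne_of_liveSel gOfRecord₁₃_succ_nonneg ppSel_succ_idem_of_liveSel slotsOfRecord₁₃_succ_eq_zero_of_dead slotsOfRecord₁₃_succ_eq_zero_of_not_mem_range slotsOfRecord₁₃_succ_eq_zero_of_slotsT_eq_zero
open B16RLeafRecord13LiveChi

variable (F : T4Family) (N : ℕ) [NeZero N]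

/-! ## §1  ROW-`rstep`-ONLY forms of the live-line chain (generic `θ`; hypothesis `hrstep` = node00-def-T's field `Provisos₁₃.rstep` as a stand-alone Π-type) -/

section RstepOnly

variable (θ : Stage13Params F N) (χ : ChiSlot F N) (p : B12.RunParams)

/-- **AT A FIXED POINT `s′` ONTO WHICH ONLY DEAD SEQUENCES ARE SELECTED, `slot_{k+1}(s′) = slotT_{k+1}(s′)` A.E. ON THE `χ_{k+1}(s′)`-SUPPORT — FROM ROW `rstep`
ALONE** (its third conjunct, the a.e. support clause; `…B16RLeafRecord13Live.slotsOfRecord₁₃_succ_ae_eq_slotsT_of_fix_of_dead` re-keyed).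
[cite: Balaban1989LargeFieldI, (0.3) p.176, p.177 (i)–(ii); Balaban1988Convergent, (3.24)–(3.25) p.270] -/
theorem slotsOfRecord₁₃_succ_ae_eq_slotsT_of_fix_of_dead_of_rstep
    (hrstep : ∀ (p : B12.RunParams) (k : ℕ) [DecidableEq (PBond (F.P p.K) (k + 1))], k < p.K →
      (towerRepOfRecord F N θ.ν θ.τ9 (slotsTOfRecord F N θ.ν θ.τ9 (EOfRecord₁₃Chi F N θ χ) (wOfRecord₉ F N θ.toStage9Params) θ.ppSel)
        θ.ppSel p (gOfRecord₁₃Chi F N θ χ p) (k + 1)).toRepData.ProvisosInt)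
    (k : ℕ) (hk : k < p.K)
    (s' : SeqOfRecord F θ.ν θ.τ9.M (gOfRecord₁₃Chi F N θ χ p) p.K (k + 1))
    (hfix : θ.ppSel p (gOfRecord₁₃Chi F N θ χ p) (k + 1) s' = s')
    (hdead : ∀ a, θ.ppSel p (gOfRecord₁₃Chi F N θ χ p) (k + 1) a = s' → a ≠ s' →
      ∀ V, B15.BasicStep.fibreIntegral (fibOfSeq F θ.ν θ.τ9 p (gOfRecord₁₃Chi F N θ χ p) (k + 1) a)
        (rterm (sliceOfRecord F N θ.ν θ.τ9.M p (gOfRecord₁₃Chi F N θ χ p) (k + 1)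
          (slotsTOfRecord F N θ.ν θ.τ9 (EOfRecord₁₃Chi F N θ χ) (wOfRecord₉ F N θ.toStage9Params) θ.ppSel p (gOfRecord₁₃Chi F N θ χ p) (k + 1))) a) V = 0) :
    ∀ᵐ V ∂(fieldMeasure (F.P p.K) (k + 1) (SU N)),
      chiSeqOfRecord F N θ.ν θ.τ9.M (gOfRecord₁₃Chi F N θ χ p) p.K (k + 1) s' V ≠ 0 →
        slotsOfRecord F N θ.ν θ.τ9 (EOfRecord₁₃Chi F N θ χ) (wOfRecord₉ F N θ.toStage9Params) θ.ppSel p (gOfRecord₁₃Chi F N θ χ p) (k + 1) s' V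
          = slotsTOfRecord F N θ.ν θ.τ9 (EOfRecord₁₃Chi F N θ χ) (wOfRecord₉ F N θ.toStage9Params) θ.ppSel p (gOfRecord₁₃Chi F N θ χ p) (k + 1) s' V := by
  have HP := (hrstep p k hk).2.2 s'
  filter_upwards [HP] with V hV
  intro hχ
  rw [slotsOfRecord_succ]
  refine rstepSlotOfRecord_of_fix_of_dead θ.ν θ.τ9 θ.ppSel p _ (k + 1) _ s' hfix (fun a ha hne W => hdead a ha hne W) V ?_ hχ
  have H : B15.BasicStep.fibreIntegral (fibOfSeq F θ.ν θ.τ9 p (gOfRecord₁₃Chi F N θ χ p) (k + 1) s')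
      (rterm (repr218OfRecord F N θ.ν θ.τ9.M (slotsTOfRecord F N θ.ν θ.τ9 (EOfRecord₁₃Chi F N θ χ)
        (wOfRecord₉ F N θ.toStage9Params) θ.ppSel) p (gOfRecord₁₃Chi F N θ χ p) (k + 1))
        (θ.ppSel p (gOfRecord₁₃Chi F N θ χ p) (k + 1) s')) V = 0 →
      rterm (repr218OfRecord F N θ.ν θ.τ9.M (slotsTOfRecord F N θ.ν θ.τ9 (EOfRecord₁₃Chi F N θ χ)
        (wOfRecord₉ F N θ.toStage9Params) θ.ppSel) p (gOfRecord₁₃Chi F N θ χ p) (k + 1)) s' V = 0 := hV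
  rw [hfix] at H
  intro h0
  apply H
  convert h0 using 2
  rfl

end RstepOnly

/-! ## §3  AT K0a's STAGE-13 LIVE RE-PIN `θ.liveRepin₁₃` (the selector clause is `rfl`): everything from `HasResidualsOfRecord` alone -/

/-! ## §4  AT THE WITNESSES CARRYING K0b's RESIDUALS: the (R₁₃) slot CLOSED -/

/-! ## v1.1 (APPEND-ONLY; dag-n11-d g44, N11-σ chain): the remaining cone declarations of this module in χ — every v1 declaration above is byte-identical -/

section V11Append

open B16RLeafRecord13AtLive hiding liveRepin₁₃_liveSel
open B16RLeafRecord13AtLiveChi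

section
variable (F : T4Family) (N : ℕ) [NeZero N]
variable (θ : Stage13Params F N) (χ : ChiSlot F N) (p : B12.RunParams)
variable (θ : Stage13Params F N) (χ : ChiSlot F N) (p : B12.RunParams)

variable {F N θ χ} in
/-- **★ AT THE LIVE SELECTOR THE ROW `rstep` IS A THEOREM OF K0b's `HasResidualsOfRecord` ALONE**: node00-def-T's §4c `rstep₁₃_of_localBg_liveSel` (def-R's
`provisosInt_towerRepOfRecord_of_sel_fixed_or_null` over the dichotomy `ppSelLiveOfRecord_fixed_or_dead`) with (H-U) DISCHARGED by seat K0c's absolute theorem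
`localBgMeasurable` and the ζ-inputs read off the (3.16) factor of record (`zetaMeasurable_zeta316OfRecord_of_localBg`, `HasResidualsOfRecord.zetaAbs`,
`zeta316OfRecord_nonneg`) — exactly the `rstep` line of K0a's `provisos₁₃_liveRepin₁₃_of_localBg`, stated as its own theorem at the selector clause.
[cite: Balaban1989LargeFieldI, (0.3)–(0.4) p.176 and p.177; Balaban1988Convergent, (2.12) p.256, (3.16) p.268, (3.22) p.269, (3.24)–(3.25) p.270 (bookkeeping)] -/
theorem rstep₁₃_of_liveSel_of_hasResiduals
    (hsel : θ.ppSel = ppSelLiveOfRecord F N θ.ν θ.τ9 (EOfRecord₁₃Chi F N θ χ) (wOfRecord₉ F N θ.toStage9Params)) (hres : θ.HasResidualsOfRecord F N) :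
    ∀ (p : B12.RunParams) (k : ℕ) [DecidableEq (PBond (F.P p.K) (k + 1))], k < p.K →
      (towerRepOfRecord F N θ.ν θ.τ9 (slotsTOfRecord F N θ.ν θ.τ9 (EOfRecord₁₃Chi F N θ χ) (wOfRecord₉ F N θ.toStage9Params) θ.ppSel)
        θ.ppSel p (gOfRecord₁₃Chi F N θ χ p) (k + 1)).toRepData.ProvisosInt :=
  have hζ : ZetaMeasurable F N θ.ζ := by
    rw [hres.zeta_eq]; exact zetaMeasurable_zeta316OfRecord_of_localBg (localBgMeasurable F N θ.ν) θ.τ9.M θ.A₁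
  have hζ0 : ∀ p g k s Pl Ql RS U V', 0 ≤ θ.ζ p g k s Pl Ql RS U V' := by
    rw [hres.zeta_eq]; exact fun p g k s Pl Ql RS U V' => zeta316OfRecord_nonneg θ.A₁ p g k s Pl Ql RS U V'
  θ.rstep₁₃_of_localBg_liveSel_chi χ hsel (localBgMeasurable F N θ.ν) hζ hres.zetaAbs hζ0

end

end V11Append

end Literature.MathematicalPhysics.QuantumFieldTheory.Balaban1983to89.B16RLeafRecord13LiveRstepChi

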